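import Mathlib
import HarnessLib
import Summits.HubbardSuperconductivity.HubbardSuperconductivity.Theorems.KLProgrammeKLRegimeSplitEvalDerivBounds
import Summits.HubbardSuperconductivity.HubbardSuperconductivity.Theorems.KLProgrammeKLRegimeSplitSymInterp

/-!
# Route `KLProgramme` — ENGINE child 19918, two-leg slot at scale `0`: derivatives of the symmetrised interpolant from the PURE
# position-space moments `Σ_x (|x̃₀| + |x̃₁|)ʲ |f_c(x)|` (the zero mode drops for `j ≥ 1`)

Cell `gate-hubbard-kl`, seat p1b (g7).  The tree bound `norm_iteratedFDeriv_evalM_symInterp_le_of_moments` reads the moments with the weight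
`(1 + |x̃₀| + |x̃₁|)ʲ`, which charges the constant mode `x = 0` (for the scale-`0` two-leg data: the O(U) Hartree tadpole and every spatially
local term) to EVERY derivative order — the reason the scale-`0` tier-1 fit could not be met (seat p1b g7, STATUS 2026-08-27T04:27:57Z).  Since
`‖Dʲ h_{m,n}‖ ≤ (m + n)ʲ` (`norm_iteratedFDeriv_harmonicM_le`), the sharp statement costs nothing:

* **`norm_iteratedFDeriv_evalM_symInterp_le_pure_moments`**: `‖Dʲ (evalM (symInterp L f)) q‖ ≤ Σ_x (|x̃₀| + |x̃₁|)ʲ · |f_c(x)|` (every `j`);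
* **`norm_iteratedFDeriv_evalM_symInterp_le_offZero_moments`**: for `1 ≤ j`, `… ≤ Σ_{x ≠ 0} (1 + |x̃₀| + |x̃₁|)ʲ · |f_c(x)|` (the engine's
  weight, restricted to the spatially OFF-DIAGONAL part of the kernel);
* `evalM_symInterp_sub` / `evalM_symInterp_add` (value-level linearity on `Momentum`, from k3c3-p1's `eval_symInterp_add/sub`).

Proofs only; no definitions; nothing about the model is asserted.  References: BGM 2006 §2.3 (2.17) [cite: BenfattoGiulianiMastropietro2006].
-/

noncomputable section

namespace Summit.HubbardSuperconductivity.HubbardSuperconductivity.Theorems.KLRegimeSplit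

set_option linter.dupNamespace false -- summit = problem name (single-conjunct summit), D-0017

open Real Finset Literature.MathematicalPhysics.QuantumLattice Literature.Probability.LatticeModels

variable (L : ℕ) [NeZero L]

/-- Value-level additivity of the interpolant on `Momentum`. -/
theorem evalM_symInterp_add (f g : TorusSite 2 L → ℝ) :
    evalM (symInterp L (fun k => f k + g k)) = fun q => evalM (symInterp L f) q + evalM (symInterp L g) q := by
  funext q
  simp only [evalM_apply, eval_symInterp_add]

/-- Value-level subtractivity of the interpolant on `Momentum`. -/
theorem evalM_symInterp_sub (f g : TorusSite 2 L → ℝ) :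
    evalM (symInterp L (fun k => f k - g k)) = fun q => evalM (symInterp L f) q - evalM (symInterp L g) q := by
  funext q
  simp only [evalM_apply, eval_symInterp_sub]

/-- **Splitting the data**: `evalM (symInterp L f) = evalM (symInterp L (f − g)) + evalM (symInterp L g)` pointwise. -/
theorem evalM_symInterp_eq_sub_add (f g : TorusSite 2 L → ℝ) (q : Momentum) :
    evalM (symInterp L f) q = evalM (symInterp L (fun k => f k - g k)) q + evalM (symInterp L g) q := by
  rw [evalM_symInterp_sub]; ring

/-- **DERIVATIVES OF THE INTERPOLANT FROM THE PURE MOMENTS**: `‖Dʲ (evalM (symInterp L f)) q‖ ≤ Σ_x (|x̃₀| + |x̃₁|)ʲ · |f_c(x)|` for every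
order `j` and every `q` (for `j ≥ 1` the site `x = 0` — the constant mode — contributes nothing). -/
theorem norm_iteratedFDeriv_evalM_symInterp_le_pure_moments (f : TorusSite 2 L → ℝ) (j : ℕ) (q : Momentum) :
    ‖iteratedFDeriv ℝ j (evalM (symInterp L f)) q‖ ≤
      ∑ x : TorusSite 2 L, (((x 0).valMinAbs.natAbs : ℝ) + ((x 1).valMinAbs.natAbs : ℝ)) ^ j * |torusCosCoeff L f x| := by
  have hfun : evalM (symInterp L f) = fun q : Momentum => ∑ x : TorusSite 2 L,
      (fun q : Momentum => torusCosCoeff L f x * TrigPolyC4v.harmonic (x 0).valMinAbs.natAbs (x 1).valMinAbs.natAbs (WithLp.ofLp q)) q := by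
    funext q
    simp only [evalM_apply, eval_symInterp]
  have hterm : ∀ x : TorusSite 2 L, ContDiff ℝ ((j : ℕ∞) : WithTop ℕ∞)
      (fun q : Momentum => torusCosCoeff L f x * TrigPolyC4v.harmonic (x 0).valMinAbs.natAbs (x 1).valMinAbs.natAbs (WithLp.ofLp q)) :=
    fun x => contDiff_const.mul (contDiff_harmonicM _ _)
  rw [hfun, iteratedFDeriv_fun_sum_apply fun x _ => (hterm x).contDiffAt]
  refine (norm_sum_le _ _).trans (sum_le_sum fun x _ => ?_)
  have hsm : (fun q : Momentum => torusCosCoeff L f x *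
      TrigPolyC4v.harmonic (x 0).valMinAbs.natAbs (x 1).valMinAbs.natAbs (WithLp.ofLp q)) =
      torusCosCoeff L f x • fun q : Momentum => TrigPolyC4v.harmonic (x 0).valMinAbs.natAbs (x 1).valMinAbs.natAbs (WithLp.ofLp q) := by
    funext q; simp [smul_eq_mul]
  rw [hsm, iteratedFDeriv_const_smul_apply ((contDiff_harmonicM _ _ (k := ((j : ℕ∞) : WithTop ℕ∞))).contDiffAt), norm_smul,
    Real.norm_eq_abs, mul_comm]
  exact mul_le_mul_of_nonneg_right (norm_iteratedFDeriv_harmonicM_le _ _ j q) (abs_nonneg _)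

/-- **For `j ≥ 1`: derivatives from the OFF-ZERO moments in the engine's weight** —
`‖Dʲ (evalM (symInterp L f)) q‖ ≤ Σ_{x ≠ 0} (1 + |x̃₀| + |x̃₁|)ʲ · |f_c(x)|`. -/
theorem norm_iteratedFDeriv_evalM_symInterp_le_offZero_moments (f : TorusSite 2 L → ℝ) {j : ℕ} (hj : 1 ≤ j) (q : Momentum) :
    ‖iteratedFDeriv ℝ j (evalM (symInterp L f)) q‖ ≤
      ∑ x ∈ (univ : Finset (TorusSite 2 L)).filter (fun x => x ≠ 0),
        (1 + ((x 0).valMinAbs.natAbs : ℝ) + ((x 1).valMinAbs.natAbs : ℝ)) ^ j * |torusCosCoeff L f x| := by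
  refine (norm_iteratedFDeriv_evalM_symInterp_le_pure_moments L f j q).trans ?_
  rw [← sum_filter_add_sum_filter_not univ (fun x : TorusSite 2 L => x ≠ 0)]
  have hzero : ∑ x ∈ univ.filter (fun x : TorusSite 2 L => ¬x ≠ 0),
      (((x 0).valMinAbs.natAbs : ℝ) + ((x 1).valMinAbs.natAbs : ℝ)) ^ j * |torusCosCoeff L f x| = 0 := by
    refine sum_eq_zero fun x hx => ?_
    have hx0 : x = 0 := by simpa using (mem_filter.1 hx).2
    subst hx0
    have hj0 : j ≠ 0 := by omega
    simp [zero_pow hj0]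
  rw [hzero, add_zero]
  refine sum_le_sum fun x _ => mul_le_mul_of_nonneg_right ?_ (abs_nonneg _)
  exact pow_le_pow_left₀ (by positivity) (by linarith) j

/-- The off-zero moment is at most the full moment (same weight): the sharp bound never loses against the tree's. -/
theorem sum_offZero_moment_le_sum_moment (f : TorusSite 2 L → ℝ) (j : ℕ) :
    ∑ x ∈ (univ : Finset (TorusSite 2 L)).filter (fun x => x ≠ 0),
        (1 + ((x 0).valMinAbs.natAbs : ℝ) + ((x 1).valMinAbs.natAbs : ℝ)) ^ j * |torusCosCoeff L f x| ≤
      ∑ x : TorusSite 2 L, (1 + ((x 0).valMinAbs.natAbs : ℝ) + ((x 1).valMinAbs.natAbs : ℝ)) ^ j * |torusCosCoeff L f x| :=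
  sum_le_sum_of_subset_of_nonneg (filter_subset _ _) fun _ _ _ => by positivity

/-- **Order `0`**: `|evalM (symInterp L f) q| ≤ Σ_x |f_c(x)|` (restated on `Momentum`). -/
theorem norm_iteratedFDeriv_zero_evalM_symInterp_le (f : TorusSite 2 L → ℝ) (q : Momentum) :
    ‖iteratedFDeriv ℝ 0 (evalM (symInterp L f)) q‖ ≤ ∑ x : TorusSite 2 L, |torusCosCoeff L f x| := by
  rw [norm_iteratedFDeriv_zero, Real.norm_eq_abs, evalM_apply]
  exact abs_symInterp_eval_le f _

end Summit.HubbardSuperconductivity.HubbardSuperconductivity.Theorems.KLRegimeSplit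

end
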